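import Summits.QuantumFields.QCD.Theorems.QuarksAsStableActionStableActionBridgeStubPermExactSymAP
import Summits.QuantumFields.QCD.Theorems.QuarksAsStableActionStableActionBridgeStubSymAPPairingNonneg
import Summits.QuantumFields.YangMills.Theorems.LangevinControlUVOSLegsFromFemtoAndGapStubAssemblyRPLimit
import Literature.MathematicalPhysics.QuantumFieldTheory.QCDTimeReflectionProofs
import HarnessLib

/-!
# The OS form of the thermal Θ-symmetrised distributions IS the thermal pairing of the smeared observable

Stub `stub_symAP_osForm_eq_pairing` of the line `Sketch` (reshape r3e) for the crux
`QuarksAsStableAction.StableActionBridge` (stmt-QuantumFields-9737).  For a finite family of species strings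
`lab j` (arities `deg j`), test functions `G j` and appended witnesses `H i j` of `ΘGᵢ* ⊗ Gⱼ`, and a non-vanishing
thermal denominator `Z_AP ≠ 0`,
  `Σᵢⱼ qcdLatticeDistSymAP sch k (deg i + deg j) (lab i ∘ rev ++ lab j) (H i j) = ⟨X · Θ_T X⟩_AP`,
`X = symSmearedObs sch k deg lab G`, `⟨Y⟩_AP = qcdTorusExpectAP`, `(Θ_T X)(U) = torusTheta (X (Θ'U))`.

Proof (pure bookkeeping, everything proved, no named fact; helpers in the sub-namespace `OsForm`).
* `Θ = torusTheta` is conjugate-linear and ORDER-REVERSING multiplicative, so `Θ` of an ordered product over `Fin n`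
  is the ordered product of the `Θ`'s composed with `Fin.rev` (`torusTheta_prod_ofFn`); the renormalised
  symmetrised insertions are Θ-covariant, `Θ (R_s(y)(Θ'U)) = R_s(θy)(U)` (`torusTheta_renormInsertionSym`, from
  `torusTheta_insertionSym` and reality of `z a⁴`, `shift`).  Hence
  `Θ (X(Θ'U)) = Σᵢ Σₓ conj Gᵢ(a x) · ∏ₗ R_{lab i (rev l)}(θ x(rev l))(U)` (`torusTheta_symSmearedObs`).
* The insertions are CENTRAL (`commute_renormInsertionSym`) and coefficient-regular
  (`coeffRegular_renormInsertionSym`), so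
  `X(U) · Θ(X(Θ'U)) = Σᵢⱼ Σ_{x,y} conj Gᵢ(a x) Gⱼ(a y) · ∏ R over the appended string (lab i ∘ rev ++ lab j)` at the
  appended sites `(θ ∘ x ∘ rev) ++ y` (`pairing_integrand_eq`).
* `qcdTorusExpectAP` is linear in the observable on coefficient-regular torus functions (Berezin integral linear,
  Bochner integral linear on bounded measurable integrands — integrability through the rotated frame,
  `fermiIntegral_eq_det_mul_spinUnrot`, as in `measurable_fermiIntegral_osPairX`).
* On the left, `qcdLatticeDistSymAP_apply` (all degrees at once when `Z_AP ≠ 0`: the degree-`0` weight is `1`), the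
  site sum over `(box)^{n+m}` splits over appended tuples, `H i j (a z) = conj Gᵢ(θ(a x ∘ rev)) Gⱼ(a y)`
  (`osAdjoint_apply`), and the `x`-sum is reindexed by the involution `x ↦ θ ∘ x ∘ rev` of `(box)^n`
  (`siteReflect_mem_box`, `timeReflection_smul_siteToE`).
References: Osterwalder–Seiler 1978 §2; Montvay–Münster 1994 §4.1.3 (4.34), §4.2.3 (4.90), (4.99). -/

noncomputable section

open scoped SchwartzMap BigOperators ComplexConjugate Matrix
open MeasureTheory
open Literature.MathematicalPhysics.QuantumFieldTheory Literature.MathematicalPhysics.QuantumLattice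
open Literature.MathematicalPhysics.QuantumLattice.GrassmannAlgebra
open Literature.MathematicalPhysics.AQFT
open Literature.Probability.LatticeModels (box Site)

local notation "E4" => EuclideanSpace ℝ (Fin 4)
local notation "𝔾" => Matrix.specialUnitaryGroup (Fin 3) ℂ

namespace Summit.QuantumFields.QCD.Cruxes.StableActionBridge.Sketch

namespace OsForm

/-! ### Bookkeeping: reflected multi-indices (appended ones: `sum_piFinset_append` of the Yang–Mills toolkit XX) -/

/-- The map `x ↦ θ ∘ x ∘ rev` preserves the multi-sites of the (reflection-symmetric) box. -/
theorem reflectRev_mem_piFinset {n R : ℕ} {x : Fin n → Site 4}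
    (hx : x ∈ Fintype.piFinset (fun _ : Fin n => box 4 R)) :
    (fun l => siteReflect (x (Fin.rev l))) ∈ Fintype.piFinset (fun _ : Fin n => box 4 R) := by
  rw [Fintype.mem_piFinset] at hx ⊢
  exact fun l => siteReflect_mem_box (hx _)

/-- The map `x ↦ θ ∘ x ∘ rev` is an involution. -/
theorem reflectRev_reflectRev {n : ℕ} (x : Fin n → Site 4) :
    (fun l => siteReflect ((fun l' => siteReflect (x (Fin.rev l'))) (Fin.rev l))) = x := by
  funext l
  simp only [Fin.rev_rev, siteReflect_siteReflect]

/-! ### `Θ` of ordered products; linearity of the thermal functional -/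

section Torus

variable {Nf L : ℕ} [NeZero L]

/-- `Θ` of a list product is the product of the `Θ`'s in reversed order (`Θ` is antimultiplicative). -/
theorem torusTheta_list_prod (l : List (FermiAlg Nf L)) : torusTheta l.prod = (l.map torusTheta).reverse.prod := by
  induction l with
  | nil => simp
  | cons a l ih =>
    rw [List.prod_cons, torusTheta_mul, ih, List.map_cons, List.reverse_cons, List.prod_append,
      List.prod_singleton]

/-- `Θ` of an ordered product over `Fin n` is the ordered product of the `Θ`'s composed with `Fin.rev`. -/
theorem torusTheta_prod_ofFn {n : ℕ} (f : Fin n → FermiAlg Nf L) :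
    torusTheta (List.ofFn f).prod = (List.ofFn fun l => torusTheta (f (Fin.rev l))).prod := by
  rw [torusTheta_list_prod, List.map_ofFn, reverse_ofFn]
  rfl

/-- **Integrability of the thermal Berezin integrands**: for a coefficient-regular torus function `Y`,
`V ↦ ∫dψ̄dψ Y(V) e^{−ψ̄D^{AP}(V)ψ}` is integrable against the Wilson probability measure (bounded and measurable:
in the rotated frame `∫dψ̄dψ y = det R · ∫dψ̄dψ R'y` and `R' e^{−ψ̄D^{AP}ψ} = e^{ψ̄Mψ}` has continuous entries). -/
theorem integrable_fermiIntegral_mul_fermiBoltzmannAP {Y : GaugeConfig 4 L 𝔾 → FermiAlg Nf L} (hY : CoeffRegular Y)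
    (mq : Fin Nf → ℝ) (β : ℝ) :
    Integrable (fun V => fermiIntegral (Y V * fermiBoltzmannAP V mq))
      (wilsonMeasure (d := 4) (L := L) (fundamentalRep (Fin 3)) β) := by
  -- adapted from `measurable_fermiIntegral_osPairX` (…StubAbstractThermalRP.lean)
  have h : CoeffRegular fun V : GaugeConfig 4 L 𝔾 => spinUnrot (Y V) * grassmannExp (quadratic ℂ (rotDirac V mq)) :=
    (hY.algHom _).mul ((coeffRegular_quadratic fun p q => continuous_rotDirac_apply mq p q).grassmannExp
      fun U => coord_empty_quadratic _)
  have he : ∀ V : GaugeConfig 4 L 𝔾, fermiIntegral (Y V * fermiBoltzmannAP V mq) =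
      LinearMap.det (blockSubst ℂ (spinBlock (Nf := Nf) (L := L) ((2 : ℂ)⁻¹ • spinWᴴ)) (spinBlock ((2 : ℂ)⁻¹ • spinWᵀ))) *
        fermiIntegral (spinUnrot (Y V) * grassmannExp (quadratic ℂ (rotDirac V mq))) := fun V => by
    rw [fermiIntegral_eq_det_mul_spinUnrot, map_mul, spinUnrot_fermiBoltzmannAP_eq]
  simp_rw [he]
  exact (Summit.QuantumFields.QCD.Cruxes.ChiralDescent.InfimumDescent.integrable_apply_of_coeffRegular h
    fermiIntegral _).const_mul _

/-- **Additivity of the thermal functional** in the observable over finite sums of coefficient-regular torus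
functions (common denominator; numerator: Berezin integral linear, Bochner integral additive on integrable terms). -/
theorem qcdTorusExpectAP_finset_sum {ι : Type*} (β : ℝ) (mq : Fin Nf → ℝ) (s : Finset ι)
    {T : ι → GaugeConfig 4 L 𝔾 → FermiAlg Nf L} (hT : ∀ t ∈ s, CoeffRegular (T t)) :
    qcdTorusExpectAP β L mq (fun U => ∑ t ∈ s, T t U) = ∑ t ∈ s, qcdTorusExpectAP β L mq (T t) := by
  unfold qcdTorusExpectAP
  rw [← Finset.sum_div]
  congr 1
  have he : ∀ U : GaugeConfig 4 L 𝔾, fermiIntegral ((∑ t ∈ s, T t U) * fermiBoltzmannAP U mq) =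
      ∑ t ∈ s, fermiIntegral (T t U * fermiBoltzmannAP U mq) := fun U => by
    rw [Finset.sum_mul, map_sum]
  simp_rw [he]
  exact integral_finsetSum _ fun t ht => integrable_fermiIntegral_mul_fermiBoltzmannAP (hT t ht) mq β

/-- **Homogeneity of the thermal functional** in the observable. -/
theorem qcdTorusExpectAP_smul (β : ℝ) (mq : Fin Nf → ℝ) (c : ℂ) (T : GaugeConfig 4 L 𝔾 → FermiAlg Nf L) :
    qcdTorusExpectAP β L mq (fun U => c • T U) = c * qcdTorusExpectAP β L mq T := by
  unfold qcdTorusExpectAP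
  rw [← mul_div_assoc]
  congr 1
  have he : ∀ U : GaugeConfig 4 L 𝔾, fermiIntegral (c • T U * fermiBoltzmannAP U mq) =
      c * fermiIntegral (T U * fermiBoltzmannAP U mq) := fun U => by
    rw [smul_mul_assoc, map_smul, smul_eq_mul]
  simp_rw [he]
  exact integral_const_mul _ _

/-- **Linearity of the thermal functional** over finite sums of scalar multiples of coefficient-regular torus
functions: `⟨Σₜ cₜ • Tₜ⟩_AP = Σₜ cₜ ⟨Tₜ⟩_AP`. -/
theorem qcdTorusExpectAP_sum_smul {ι : Type*} (β : ℝ) (mq : Fin Nf → ℝ) (s : Finset ι) (c : ι → ℂ)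
    {T : ι → GaugeConfig 4 L 𝔾 → FermiAlg Nf L} (hT : ∀ t, CoeffRegular (T t)) :
    qcdTorusExpectAP β L mq (fun U => ∑ t ∈ s, c t • T t U) = ∑ t ∈ s, c t * qcdTorusExpectAP β L mq (T t) := by
  rw [qcdTorusExpectAP_finset_sum β mq s fun t _ => (hT t).const_smul (c t)]
  exact Finset.sum_congr rfl fun t _ => qcdTorusExpectAP_smul β mq (c t) (T t)

end Torus

/-! ### The scheme's symmetrised insertions: Θ-covariance, central and regular ordered products -/

variable {Nf : ℕ}

/-- **Θ-covariance of the renormalised symmetrised insertions**: `Θ (R_s(y)(Θ'U)) = R_s(θy)(U)` (the scalars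
`z_s(k) a_k⁴` and `shift_s(k)` are real). -/
theorem torusTheta_renormInsertionSym (sch : QCDScheme Nf) (k : ℕ) (s : QCDField Nf) (y : Site 4)
    (U : GaugeConfig 4 (sch.side k) 𝔾) :
    torusTheta (renormInsertionSym sch k s y U.negReflect) = renormInsertionSym sch k s (siteReflect y) U := by
  unfold renormInsertionSym
  rw [LinearMap.map_smulₛₗ, map_sub, torusTheta_insertionSym, torusTheta_algebraMap, Complex.conj_ofReal,
    Complex.conj_ofReal]

/-- Ordered products of renormalised symmetrised insertions are central. -/
theorem prod_renormInsertionSym_commute (sch : QCDScheme Nf) (k : ℕ) {n : ℕ} (σ : Fin n → QCDField Nf)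
    (x : Fin n → Site 4) (U : GaugeConfig 4 (sch.side k) 𝔾) (z : FermiAlg Nf (sch.side k)) :
    Commute (List.ofFn fun l => renormInsertionSym sch k (σ l) (x l) U).prod z :=
  Commute.list_prod_left _ _ fun w hw => by
    obtain ⟨l, rfl⟩ := List.mem_ofFn.1 hw
    exact commute_renormInsertionSym sch k (σ l) (x l) U z

/-- Ordered products of renormalised symmetrised insertions are coefficient-regular. -/
theorem prod_renormInsertionSym_coeffRegular (sch : QCDScheme Nf) (k : ℕ) {n : ℕ} (σ : Fin n → QCDField Nf)
    (x : Fin n → Site 4) :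
    CoeffRegular (fun U : GaugeConfig 4 (sch.side k) 𝔾 =>
      (List.ofFn fun l => renormInsertionSym sch k (σ l) (x l) U).prod) :=
  coeffRegular_prod_ofFn fun l => coeffRegular_renormInsertionSym sch k (σ l) (x l)

/-- **The product of the reflected block and of the forward block is the ordered product over the appended
string** `(σ ∘ rev) ++ τ` at the appended sites `(θ ∘ x ∘ rev) ++ y`. -/
theorem reflProd_mul_prod (sch : QCDScheme Nf) (k : ℕ) {n m : ℕ} (σ : Fin n → QCDField Nf) (x : Fin n → Site 4)
    (τ : Fin m → QCDField Nf) (y : Fin m → Site 4) (U : GaugeConfig 4 (sch.side k) 𝔾) :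
    (List.ofFn fun l => renormInsertionSym sch k (σ (Fin.rev l)) (siteReflect (x (Fin.rev l))) U).prod *
        (List.ofFn fun l => renormInsertionSym sch k (τ l) (y l) U).prod =
      (List.ofFn fun l => renormInsertionSym sch k (Fin.append (σ ∘ Fin.rev) τ l)
        (Fin.append (fun l => siteReflect (x (Fin.rev l))) y l) U).prod := by
  rw [← List.prod_append, ← List.ofFn_fin_append]
  congr 2
  funext l
  refine Fin.addCases (fun i => ?_) (fun j => ?_) l
  · simp only [Fin.append_left, Function.comp_apply]
  · simp only [Fin.append_right]

/-! ### `Θ` of the smeared observable and the pairing integrand -/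

/-- **`Θ` of the smeared symmetrised observable read in the reflected background**:
`Θ (X(Θ'U)) = Σᵢ Σₓ conj Gᵢ(a x) · ∏ₗ R_{lab i (rev l)}(θ x(rev l))(U)` (conjugate-linearity, order reversal,
Θ-covariance). -/
theorem torusTheta_symSmearedObs (sch : QCDScheme Nf) (k : ℕ) {N : ℕ} (deg : Fin N → ℕ)
    (lab : (j : Fin N) → Fin (deg j) → QCDField Nf) (G : (j : Fin N) → 𝓢((Fin (deg j) → E4), ℂ))
    (U : GaugeConfig 4 (sch.side k) 𝔾) :
    torusTheta (symSmearedObs sch k deg lab G U.negReflect) =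
      ∑ i, ∑ x ∈ Fintype.piFinset (fun _ : Fin (deg i) => box 4 (sch.L k)),
        conj (G i (fun l => sch.a k • siteToE (x l))) •
          (List.ofFn fun l => renormInsertionSym sch k (lab i (Fin.rev l)) (siteReflect (x (Fin.rev l))) U).prod := by
  unfold symSmearedObs
  rw [map_sum]
  refine Finset.sum_congr rfl fun i _ => ?_
  rw [map_sum]
  refine Finset.sum_congr rfl fun x _ => ?_
  rw [LinearMap.map_smulₛₗ, torusTheta_prod_ofFn]
  simp only [torusTheta_renormInsertionSym]

/-- **The pairing integrand, expanded**: `X(U) · Θ(X(Θ'U)) = Σᵢⱼ Σ_{x,y} (conj Gᵢ(a x) Gⱼ(a y)) • ∏ R` over the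
appended string `(lab i ∘ rev) ++ lab j` at the appended sites `(θ ∘ x ∘ rev) ++ y` (bilinear expansion; the two
blocks are swapped through centrality). -/
theorem pairing_integrand_eq (sch : QCDScheme Nf) (k : ℕ) {N : ℕ} (deg : Fin N → ℕ)
    (lab : (j : Fin N) → Fin (deg j) → QCDField Nf) (G : (j : Fin N) → 𝓢((Fin (deg j) → E4), ℂ))
    (U : GaugeConfig 4 (sch.side k) 𝔾) :
    symSmearedObs sch k deg lab G U * torusTheta (symSmearedObs sch k deg lab G U.negReflect) =
      ∑ i, ∑ j, ∑ x ∈ Fintype.piFinset (fun _ : Fin (deg i) => box 4 (sch.L k)),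
        ∑ y ∈ Fintype.piFinset (fun _ : Fin (deg j) => box 4 (sch.L k)),
          (conj (G i (fun l => sch.a k • siteToE (x l))) * G j (fun l => sch.a k • siteToE (y l))) •
            (List.ofFn fun l => renormInsertionSym sch k (Fin.append (lab i ∘ Fin.rev) (lab j) l)
              (Fin.append (fun l => siteReflect (x (Fin.rev l))) y l) U).prod := by
  rw [torusTheta_symSmearedObs]
  unfold symSmearedObs
  rw [Finset.sum_mul_sum, Finset.sum_comm]
  refine Finset.sum_congr rfl fun i _ => Finset.sum_congr rfl fun j _ => ?_
  rw [Finset.sum_mul_sum, Finset.sum_comm]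
  refine Finset.sum_congr rfl fun x _ => Finset.sum_congr rfl fun y _ => ?_
  rw [smul_mul_smul_comm, mul_comm (G j _), (prod_renormInsertionSym_commute sch k (lab j) y U _).eq,
    reflProd_mul_prod]

/-! ### The left-hand side: the OS form block by block -/

/-- The degree-`0` thermal weight is `1` when the thermal denominator does not vanish. -/
theorem qcdTorusMomentSymAP_zero (sch : QCDScheme Nf) (k : ℕ)
    (hZ : (∫ U, fermiIntegral (fermiBoltzmannAP U fun fl => sch.mq fl k) ∂(qcdGaugeMeasure sch k)) ≠ 0)
    (σ : Fin 0 → QCDField Nf) (x : Fin 0 → Site 4) : qcdTorusMomentSymAP sch k σ x = 1 := by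
  unfold qcdTorusMomentSymAP qcdTorusExpectAP
  simp only [List.ofFn_zero, List.prod_nil, one_mul]
  exact div_self hZ

/-- `qcdLatticeDistSymAP … F = ∑ₓ W^{AP,sym}_σ(x) F(a_k x)` in EVERY degree when `Z_AP ≠ 0` (in degree `0` the
sum has the single term `x = pt` with weight `1`). -/
theorem qcdLatticeDistSymAP_apply_of_ne_zero (sch : QCDScheme Nf) (k : ℕ)
    (hZ : (∫ U, fermiIntegral (fermiBoltzmannAP U fun fl => sch.mq fl k) ∂(qcdGaugeMeasure sch k)) ≠ 0)
    {n : ℕ} (σ : Fin n → QCDField Nf) (F : 𝓢((Fin n → E4), ℂ)) :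
    qcdLatticeDistSymAP sch k n σ F =
      ∑ x ∈ Fintype.piFinset (fun _ : Fin n => box 4 (sch.L k)),
        qcdTorusMomentSymAP sch k σ x * F (fun i => sch.a k • siteToE (x i)) := by
  rcases Nat.eq_zero_or_pos n with rfl | hn
  · rw [qcdLatticeDistSymAP_zero_apply, Fintype.piFinset_of_isEmpty, Fintype.sum_unique,
      qcdTorusMomentSymAP_zero sch k hZ, one_mul]
    exact congrArg F (Subsingleton.elim _ _)
  · exact qcdLatticeDistSymAP_apply sch k hn.ne' σ F

/-- **One block of the OS form.**  For a witness `H` of `ΘGᵢ* ⊗ Gⱼ`: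
`Λ^{AP,sym}_{(σ∘rev) ++ τ}(H) = Σ_{x,y} conj Gᵢ(a x) Gⱼ(a y) W^{AP,sym}_{(σ∘rev) ++ τ}((θ ∘ x ∘ rev) ++ y)` — split the
site sum over appended tuples, evaluate `H` (`osAdjoint_apply`), and reindex the first block by the involution
`x ↦ θ ∘ x ∘ rev` of `(box)^n`. -/
theorem osForm_block (sch : QCDScheme Nf) (k : ℕ)
    (hZ : (∫ U, fermiIntegral (fermiBoltzmannAP U fun fl => sch.mq fl k) ∂(qcdGaugeMeasure sch k)) ≠ 0)
    {n m : ℕ} (σ : Fin n → QCDField Nf) (τ : Fin m → QCDField Nf) (Gi : 𝓢((Fin n → E4), ℂ))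
    (Gj : 𝓢((Fin m → E4), ℂ)) (H : 𝓢((Fin (n + m) → E4), ℂ)) (hH : IsAppendTensorOf H (osAdjoint Gi) Gj) :
    qcdLatticeDistSymAP sch k (n + m) (Fin.append (σ ∘ Fin.rev) τ) H =
      ∑ x ∈ Fintype.piFinset (fun _ : Fin n => box 4 (sch.L k)),
        ∑ y ∈ Fintype.piFinset (fun _ : Fin m => box 4 (sch.L k)),
          conj (Gi (fun l => sch.a k • siteToE (x l))) * Gj (fun l => sch.a k • siteToE (y l)) *
            qcdTorusMomentSymAP sch k (Fin.append (σ ∘ Fin.rev) τ)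
              (Fin.append (fun l => siteReflect (x (Fin.rev l))) y) := by
  rw [qcdLatticeDistSymAP_apply_of_ne_zero sch k hZ,
    Summit.QuantumFields.YangMills.Theorems.OSLegsFromFemtoAndGap.sum_piFinset_append]
  -- reindex the first block by the involution `x ↦ θ ∘ x ∘ rev`
  refine Finset.sum_nbij' (fun x => fun l => siteReflect (x (Fin.rev l))) (fun x => fun l => siteReflect (x (Fin.rev l)))
    (fun x hx => reflectRev_mem_piFinset hx) (fun x hx => reflectRev_mem_piFinset hx)
    (fun x _ => reflectRev_reflectRev x) (fun x _ => reflectRev_reflectRev x) (fun x _ => ?_)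
  rw [reflectRev_reflectRev]
  refine Finset.sum_congr rfl fun y _ => ?_
  rw [hH, osAdjoint_apply]
  simp only [Function.comp_def, Fin.append_left, Fin.append_right, timeReflection_smul_siteToE]
  ring

end OsForm

/-- **Stub `stub_symAP_osForm_eq_pairing` (r3e, wave 3; the OS form IS the thermal pairing of the smeared observable).**
For every finite family of species strings and test functions `Gⱼ` with appended witnesses `H i j` of `ΘGᵢ* ⊗ Gⱼ`,
and a non-vanishing thermal denominator, `Σᵢⱼ Λₖ(H i j) = ⟨X · ΘX⟩_AP` with `X = symSmearedObs sch k deg lab G`: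
expand both sides over site tuples (`qcdLatticeDistSymAP_apply`, `osAdjoint_apply`, `IsAppendTensorOf`), reindex
the reflected block by `x ↦ θ ∘ x ∘ rev` (the box is `θ`-symmetric), use the Θ-covariance `torusTheta_insertionSym`
and `torusTheta_mul` (order reversal) to recognise `Θ (X (Θ'U))`, linearity of `qcdTorusExpectAP` in the
observable, and centrality of the (even) insertions to match the pairing order; degree-`0` members are the
constants `G(pt) • 1` (here `Z_AP ≠ 0` is used). -/
theorem stub_symAP_osForm_eq_pairing : ∀ {Nf : ℕ} (sch : QCDScheme Nf) (k : ℕ),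
    (∫ U, fermiIntegral (fermiBoltzmannAP U fun fl => sch.mq fl k) ∂(qcdGaugeMeasure sch k)) ≠ 0 →
    ∀ {N : ℕ} (deg : Fin N → ℕ) (lab : (j : Fin N) → Fin (deg j) → QCDField Nf)
      (G : (j : Fin N) → 𝓢((Fin (deg j) → E4), ℂ)) (H : (i j : Fin N) → 𝓢((Fin (deg i + deg j) → E4), ℂ)),
      (∀ i j, IsAppendTensorOf (H i j) (osAdjoint (G i)) (G j)) →
      ∑ i, ∑ j, qcdLatticeDistSymAP sch k (deg i + deg j) (Fin.append (lab i ∘ Fin.rev) (lab j)) (H i j) =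
        qcdTorusExpectAP (sch.β k) (sch.side k) (fun fl => sch.mq fl k)
          (fun U => symSmearedObs sch k deg lab G U * torusTheta (symSmearedObs sch k deg lab G U.negReflect)) := by
  intro Nf sch k hZ N deg lab G H hH
  -- regularity of the elementary terms of the expanded integrand
  have hT : ∀ (i j : Fin N) (x : Fin (deg i) → Site 4) (y : Fin (deg j) → Site 4),
      CoeffRegular (fun U : GaugeConfig 4 (sch.side k) 𝔾 =>
        (List.ofFn fun l => renormInsertionSym sch k (Fin.append (lab i ∘ Fin.rev) (lab j) l)
          (Fin.append (fun l => siteReflect (x (Fin.rev l))) y l) U).prod) :=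
    fun i j x y => OsForm.prod_renormInsertionSym_coeffRegular sch k _ _
  -- right-hand side: expand the integrand and use linearity of the thermal functional
  have hexp := congrArg (qcdTorusExpectAP (sch.β k) (sch.side k) (fun fl => sch.mq fl k))
    (funext fun U => OsForm.pairing_integrand_eq sch k deg lab G U)
  rw [hexp, OsForm.qcdTorusExpectAP_finset_sum]
  · refine Finset.sum_congr rfl fun i _ => ?_
    rw [OsForm.qcdTorusExpectAP_finset_sum]
    · refine Finset.sum_congr rfl fun j _ => ?_
      -- left-hand side, block `(i, j)`
      rw [OsForm.osForm_block sch k hZ (lab i) (lab j) (G i) (G j) (H i j) (hH i j),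
        OsForm.qcdTorusExpectAP_finset_sum]
      · refine Finset.sum_congr rfl fun x _ => ?_
        rw [OsForm.qcdTorusExpectAP_sum_smul _ _ _ _ (hT i j x)]
        rfl
      · intro x _
        exact CoeffRegular.sum _ fun y _ => (hT i j x y).const_smul _
    · intro j _
      exact CoeffRegular.sum _ fun x _ => CoeffRegular.sum _ fun y _ => (hT i j x y).const_smul _
  · intro i _
    exact CoeffRegular.sum _ fun j _ => CoeffRegular.sum _ fun x _ => CoeffRegular.sum _ fun y _ =>
      (hT i j x y).const_smul _

end Summit.QuantumFields.QCD.Cruxes.StableActionBridge.Sketch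

end
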